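import Literature.NumberTheory.Transcendental.BrownMotivicCoactionCoassociative
import HarnessLib

/-!
# Goncharov's coaction formula is Ihara's group law (Brown's Theorem 2.4 from [DG05, 5.11–5.12])

[Brown2012, §2.1]: "The action of `G^{MT}` on `₀Π₁` factors through the action of `A` on `₀Π₁`. The
latter was computed by Ihara as follows (see [DG], 5.15) … Via this identification
[`a ↦ a.₀1₁ : A ≅ ₀Π₁`, (2.4)], the action of `A` on `₀Π₁` can be computed explicitly … The dual
coaction `Δ : 𝒪(₀Π₁) → 𝒪(A) ⊗ 𝒪(₀Π₁)` (2.5) was computed by Goncharov in [GG], Theorem 1.2, except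
that the two right-hand factors are interchanged", whence **Theorem 2.4**: the motivic coaction is
given by Goncharov's formula (2.18). [DeligneGoncharov2005, Prop. 5.11 and (5.12.1)]: the
automorphism group `V_ω` of the de Rham fundamental groupoid (paths between the tangential base
points `0, 1`, local monodromies `exp(e₀)`, `exp(e₁)` fixed) is identified with `Π` by
`v ↦ v(1_{1,0})`, `v` acting on `Π_{1,0}` by `⟨a⟩_{1,0} : g ↦ a·⟨a⟩₀(g)` with
`⟨a⟩₀ : e₀ ↦ e₀, e₁ ↦ a⁻¹ e₁ a` ((5.11.4)–(5.11.5)); the transported group law is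
`a ∘ b = a·⟨a⟩₀(b)` ((5.12.1)).

This file proves, in the coordinates of `GoncharovFormalIteratedIntegralsProofs.lean`
(`WordSeries`, `phi`, `psi`, `contr`, `conv`) and of `BrownMotivicGaloisData.lean` (`coactionG`,
`galoisFactor`, built from the tree's `Im` with I0, I1, I3), that the two descriptions AGREE:
Goncharov's coproduct, read through a point `a` of `₀Π₁` on its Galois (gap) side, is the
transpose of Ihara's map `x ↦ ⟨a⟩(x)·a`. Precisely:

* `conjWord K p c` — for a family `K(x; w; y)` satisfying the path composition (iii)
  (`Φ_{x,y}Φ_{y,z} = Φ_{x,z}`) and a base point `p`, the word `c = c₁⋯c_k` with each letter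
  conjugated, `∏ᵢ Φ_{p,cᵢ} cᵢ Φ_{cᵢ,p}`; `psi_eq_conjWord`: Goncharov's
  `Ψ^K(x; c; y) = Φ_{x,c₁} c₁ Φ_{c₁,c₂} ⋯ c_k Φ_{c_k,y}` ([Goncharov2005, Thm 2.5]) factors as
  `Φ_{x,p} · conjWord(c) · Φ_{p,y}` (insert `Φ_{cᵢ,p}Φ_{p,cᵢ₊₁} = Φ_{cᵢ,cᵢ₊₁}`), so the automorphism
  `F_K` of the path algebra is, on paths from `p`, the substitution `e_c ↦ Φ_{p,c} e_c Φ_{c,p}`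
  followed by right multiplication (`conv_eq_conjWord`) — any alphabet `S`.
* `S = {0,1}`, `p = 0`, `K` = the family `Iᵐ_a(x; w; y)` of a point `a` of `₀Π₁` extended to all
  endpoints by I0, I1, I3 (`Φ_{0,1} = a`, `Φ_{1,0} = a⁻¹`, `Φ_{0,0} = Φ_{1,1} = 1`): the
  substitution is **Ihara's** `⟨a⟩ : e₀ ↦ e₀, e₁ ↦ a e₁ a⁻¹` (`iharaWord`) and
  `Σ_{splittings of w} (∏ Iᵐ_a(gaps)) · x(kept letters) = (⟨a⟩(x) · a)(w)` for every series `x`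
  (`conv_eq_iharaMul`): Goncharov's formula (2.18) with the Galois factor evaluated at `a` IS the
  action `x ↦ ⟨a⟩(x)·a` of `a ∈ A ≅ ₀Π₁` on `x ∈ ₀Π₁`. This is [DG05, (5.11.5)/(5.12.1)] written in
  Brown's orientation of words (Brown lists the letters of `Iᵐ(0; a₁…a_n; 1)` from the endpoint
  `0`, [DG05, 5.16] from the endpoint `1`; reversal of words is an anti-automorphism of
  concatenation, turning `a·⟨a⟩₀(b)`, `⟨a⟩₀(e₁) = a⁻¹e₁a`, into `⟨a⟩(b)·a`, `⟨a⟩(e₁) = a e₁ a⁻¹`).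
* Consequently the hypothesis `ρ_coalg` of `MotivicGaloisData.ofCoalgebraMap` — "`ρ` intertwines
  Goncharov's coproduct with deconcatenation" — is literally the statement that the orbit map
  `g ↦ g·₀1₁`, `G_𝒰' → ₀Π₁`, is a HOMOMORPHISM for Ihara's law at the universal pair of points
  `(inl, inr)` of `G_𝒰'` (whose product is the generic point `dec` of `G_𝒰'`):
  `(gh)·₀1₁ = ⟨g·₀1₁⟩(h·₀1₁) · (g·₀1₁)` (`coalgRHS_eq_iharaMul`). The constructor
  `MotivicGaloisData.ofIharaHom` takes the input in this form ([DG05, (5.10.3), Prop. 5.11,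
  (5.12.1), (5.15.1)]: `G_ω = 𝔾_m ⋉ U_ω → H_ω = 𝔾_m ⋉ V_ω`, `V_ω ≅ (Π, ∘)`), and Brown's
  Theorem 2.4 (the coaction is Goncharov's formula) becomes a theorem of the tree rather than part
  of the hypothesis.

No named fact is introduced.

## References

* F. Brown, *Mixed Tate motives over ℤ*, Ann. of Math. 175 (2012), §2.1 (2.3)–(2.6), Thm 2.4;
  arXiv:1102.1312. [Brown2012]
* P. Deligne, A. B. Goncharov, *Groupes fondamentaux motiviques de Tate mixte*, Ann. Sci. ÉNS 38
  (2005), 5.10–5.12, 5.15; arXiv:math/0302267. [DeligneGoncharov2005]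
* A. B. Goncharov, *Galois symmetries of fundamental groupoids and noncommutative geometry*, Duke
  Math. J. 128 (2005), Thm 1.2, §2.2 Thm 2.5; arXiv:math/0208144. [Goncharov2005]
-/

noncomputable section

open scoped BigOperators

namespace Literature.NumberTheory.Transcendental

namespace GoncharovFormalIteratedIntegrals

universe u v

variable {S : Type u} {B : Type v} [CommRing B] [DecidableEq S]

open WordSeries

/-! ## Conjugated words: `F_K` on paths from a base point is a substitution -/

omit [DecidableEq S] in
/-- A non-zero coefficient of a product has a non-zero coefficient of the right factor on a
suffix. [folklore] -/
theorem exists_apply_drop_ne_zero {f g : WordSeries S B} {w : List S} (h : (f * g) w ≠ 0) :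
    ∃ k, g (w.drop k) ≠ 0 := by
  rw [mul_apply] at h
  obtain ⟨k, -, hk⟩ := Finset.exists_ne_zero_of_sum_ne_zero h
  exact ⟨k, right_ne_zero_of_mul hk⟩

omit [DecidableEq S] in
/-- A non-zero coefficient of a product has a non-zero coefficient of the left factor on a
prefix. [folklore] -/
theorem exists_apply_take_ne_zero {f g : WordSeries S B} {w : List S} (h : (f * g) w ≠ 0) :
    ∃ k, f (w.take k) ≠ 0 := by
  rw [mul_apply] at h
  obtain ⟨k, -, hk⟩ := Finset.exists_ne_zero_of_sum_ne_zero h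
  exact ⟨k, left_ne_zero_of_mul hk⟩

/-- **The conjugated word** of `c = c₁ ⋯ c_k` at the base point `p`:
`conjWord K p c = ∏ᵢ Φ_{p,cᵢ} · cᵢ · Φ_{cᵢ,p}` — the image of the word `c` under the substitution
`e_s ↦ Φ_{p,s} e_s Φ_{s,p}` ([DG05, (5.11.4)]: `⟨a⟩₀ : e₀ ↦ e₀, e₁ ↦ Ad(a⁻¹)(e₁)`).
[cite: DeligneGoncharov2005, (5.11.4); Goncharov2005, Thm 2.5] -/
def conjWord (K : S → List S → S → B) (p : S) : List S → WordSeries S B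
  | [] => 1
  | k :: c => phi K p k * X k * (phi K k p * conjWord K p c)

/-- `conjWord K p ∅ = 1`. [folklore] -/
@[simp] theorem conjWord_nil (K : S → List S → S → B) (p : S) : conjWord K p [] = 1 := rfl

/-- `conjWord K p (k c) = Φ_{p,k} k Φ_{k,p} · conjWord K p c`. [folklore] -/
theorem conjWord_cons (K : S → List S → S → B) (p k : S) (c : List S) :
    conjWord K p (k :: c) = phi K p k * X k * (phi K k p * conjWord K p c) := rfl

/-- **Triangularity**: `conjWord K p c` is supported on words containing `c` as a subword.
[folklore] -/
theorem conjWord_apply_ne_zero (K : S → List S → S → B) (p : S) :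
    ∀ (c w : List S), conjWord K p c w ≠ 0 → List.Sublist c w
  | [], w, _ => List.nil_sublist w
  | k :: c, w, h =>
    mul_X_mul_apply_ne_zero (fun w' h' => by
      obtain ⟨j, hj⟩ := exists_apply_drop_ne_zero h'
      exact (conjWord_apply_ne_zero K p c _ hj).trans (List.drop_sublist j w')) _ w h

/-- **`Ψ^K` through a base point.** If `K` satisfies the path composition (iii),
`Φ_{x,y} Φ_{y,z} = Φ_{x,z}`, then for every base point `p`,
`Ψ^K(x; c; y) = Φ_{x,p} · conjWord K p c · Φ_{p,y}`: insert `Φ_{cᵢ,cᵢ₊₁} = Φ_{cᵢ,p} Φ_{p,cᵢ₊₁}`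
in `Ψ^K(x; c; y) = Φ_{x,c₁} c₁ Φ_{c₁,c₂} c₂ ⋯ c_k Φ_{c_k,y}`. Thus the automorphism `F_K` of the
path algebra acts on paths from `p` to `q` by the substitution `e_s ↦ Φ_{p,s} e_s Φ_{s,p}`
followed by right multiplication by `Φ_{p,q}` ([DG05, (5.11.5)]: `g ↦ a·⟨a⟩₀(g)`).
[cite: Goncharov2005, Thm 2.5; DeligneGoncharov2005, Prop. 5.11] -/
theorem psi_eq_conjWord {K : S → List S → S → B}
    (hK : ∀ a y b, phi K a y * phi K y b = phi K a b) (p : S) :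
    ∀ (c : List S) (x y : S), psi K x c y = phi K x p * conjWord K p c * phi K p y
  | [], x, y => by rw [psi_nil, conjWord_nil, mul_one, hK]
  | k :: c, x, y => by
    rw [psi_cons, psi_eq_conjWord hK p c k y, conjWord_cons, ← hK x p k]
    simp only [mul_assoc]

/-- **Goncharov's `Δ` read through `K` on its gap side is `F_K`, a substitution**: for `K` with
(iii) and any base point `p`,
`conv J K (a; w; b) = (Φ_{a,p} · ⟨Φ^J_{a,b}, conjWord K p⟩ · Φ_{p,b})(w)`, where
`⟨f, conjWord K p⟩ = Σ_c f(c) conjWord K p c` is the substitution `e_s ↦ Φ_{p,s} e_s Φ_{s,p}`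
applied to the series `f`. [cite: Goncharov2005, Thm 2.5; DeligneGoncharov2005, Prop. 5.11] -/
theorem conv_eq_conjWord {K : S → List S → S → B}
    (hK : ∀ a y b, phi K a y * phi K y b = phi K a b) (p : S) (J : S → List S → S → B)
    (a b : S) (w : List S) :
    conv J K a w b = (phi K a p * contr (phi J a b) (conjWord K p) * phi K p b) w := by
  have tri : ∀ c w', (conjWord K p c * phi K p b) w' ≠ 0 → List.Sublist c w' := fun c w' h => by
    obtain ⟨j, hj⟩ := exists_apply_take_ne_zero h
    exact (conjWord_apply_ne_zero K p c _ hj).trans (List.take_sublist j w')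
  rw [conv_eq_contr,
    show (fun c => psi K a c b) = fun c => phi K a p * (conjWord K p c * phi K p b) from
      funext fun c => by rw [psi_eq_conjWord hK p c a b, mul_assoc],
    contr_const_mul _ _ tri, contr_mul_const _ _ (conjWord_apply_ne_zero K p), mul_assoc]

/-! ## Two base points: Ihara's substitution `⟨a⟩` and the map `x ↦ ⟨a⟩(x)·a` -/

section Ihara

variable (K : Bool → List Bool → Bool → B)

/-- **Ihara's substitution** `⟨a⟩` on words, for the family `K = Iᵐ_a` of a point `a` of `₀Π₁`
(`Φ_{0,1} = a`, `Φ_{1,0} = a⁻¹`, `Φ_{0,0} = Φ_{1,1} = 1`): `e₀ ↦ Φ_{0,0} e₀ Φ_{0,0} = e₀`,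
`e₁ ↦ Φ_{0,1} e₁ Φ_{1,0} = a e₁ a⁻¹` — [DG05, (5.11.4)] `⟨a⟩₀ : e₀ ↦ e₀, e₁ ↦ a⁻¹e₁a` in
Brown's (reversed) orientation of words. [cite: DeligneGoncharov2005, (5.11.4); Brown2012, §2.1
(2.4)] -/
def iharaWord : List Bool → WordSeries Bool B := conjWord K false

/-- **Ihara's map** `x ↦ ⟨a⟩(x) · a` on series of paths from `0` to `1` ([DG05, (5.11.5)]
`⟨a⟩_{1,0} : g ↦ a·⟨a⟩₀(g)`, and the group law (5.12.1) `a ∘ b = a·⟨a⟩₀(b)` of `V_ω ≅ Π`, in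
Brown's orientation), for the family `K = Iᵐ_a` of the point `a = Φ^K_{0,1}`.
[cite: DeligneGoncharov2005, (5.11.5), (5.12.1); Brown2012, §2.1 (2.4)] -/
def iharaMul (x : WordSeries Bool B) : WordSeries Bool B :=
  contr x (iharaWord K) * phi K false true

/-- `⟨a⟩(e₀) = e₀` when `Φ_{0,0} = 1`. [cite: DeligneGoncharov2005, (5.11.1), (5.11.4)] -/
theorem iharaWord_false (h00 : phi K false false = 1) : iharaWord K [false] = X false := by
  rw [iharaWord, conjWord_cons, conjWord_nil, h00, one_mul, mul_one, mul_one]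

/-- `⟨a⟩(e₁) = Φ_{0,1} e₁ Φ_{1,0} = a e₁ a⁻¹`. [cite: DeligneGoncharov2005, (5.11.2), (5.11.4)] -/
theorem iharaWord_true : iharaWord K [true] = phi K false true * X true * phi K true false := by
  rw [iharaWord, conjWord_cons, conjWord_nil, mul_one]

/-- `⟨a⟩(1)·a = a`: the unit path goes to the point `a` ("`a ↦ a.₀1₁`", (2.4)).
[cite: Brown2012, §2.1 (2.4); DeligneGoncharov2005, Prop. 5.11] -/
theorem iharaMul_one : iharaMul K 1 = phi K false true := by
  rw [iharaMul]
  suffices h : contr (1 : WordSeries Bool B) (iharaWord K) = 1 by rw [h, one_mul]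
  ext w
  rw [contr_apply, Finset.sum_eq_single_of_mem ([] : List Bool)
    (mem_subwords.2 (List.nil_sublist w)) fun c _ hc => ?_]
  · rw [one_nil, one_mul, iharaWord, conjWord_nil]
  · obtain ⟨s, c, rfl⟩ := List.exists_cons_of_ne_nil hc
    rw [one_cons, zero_mul]

/-- **Goncharov's formula is Ihara's map (Brown's Theorem 2.4 ⇐ [DG05, 5.11–5.12]).** For a
family `K` on `{0,1}` with the path composition (iii) and `Φ_{0,0} = 1` (e.g. `K = Iᵐ_a`, the
point `a = Φ_{0,1}` of `₀Π₁` extended to all endpoints by I0, I1, I3) and ANY family `J`,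
`Σ_{splittings of w} J(0; kept; 1) · ∏ K(gaps) = (⟨a⟩(Φ^J_{0,1}) · a)(w)`:
Goncharov's coproduct (2.5)/(2.18) paired with `a` on the Galois side and `x = Φ^J_{0,1}` on the
other IS the coefficient of `w` in `⟨a⟩(x)·a` — the action of `a ∈ A ≅ ₀Π₁` computed by Ihara
([Brown2012, §2.1]: "(2.5) was computed by Goncharov in [GG], Theorem 1.2, except that the two
right-hand factors are interchanged"). [cite: Brown2012, §2.1 (2.4)–(2.5), Theorem 2.4;
DeligneGoncharov2005, Prop. 5.11, (5.12.1); Goncharov2005, Thm 1.2, Thm 2.5] -/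
theorem conv_eq_iharaMul (hK : ∀ a y b, phi K a y * phi K y b = phi K a b)
    (h00 : phi K false false = 1) (J : Bool → List Bool → Bool → B) (w : List Bool) :
    conv J K false w true = iharaMul K (phi J false true) w := by
  rw [conv_eq_conjWord hK false J false true w, h00, one_mul, iharaMul, iharaWord]

end Ihara

end GoncharovFormalIteratedIntegrals

namespace Brown2012

open MZV ShuffleMonoidAlgebra
open GoncharovFormalIteratedIntegrals (splittings conv iharaMul iharaWord conv_eq_iharaMul
  iharaMul_one)
open GoncharovFormalIteratedIntegrals renaming phi → phiK, phi_apply → phiK_apply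
open GoncharovFormalIteratedIntegrals.WordSeries (X)

/-! ## The family `Iᵐ_a` of a point and the orbit map at the universal pair of points -/

section Point

variable {B : Type} [CommRing B] [Algebra ℚ B] (a : List Bool → B)

/-- For the family `Iᵐ_a` of a point `a` (a character of `𝒪(₀Π₁)`): the path composition (iii)
`Φ_{x,y}Φ_{y,z} = Φ_{x,z}` (`Im_path`). [cite: Brown2012, §2.4 I0–I3; Goncharov2005, Prop 2.2] -/
theorem phiK_Im_mul (ha1 : a [] = 1)
    (hamul : ∀ u v : List Bool, a u * a v = ((shuffleWord u v).map a).sum) (x y z : Bool) :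
    phiK (Im a) x y * phiK (Im a) y z = phiK (Im a) x z := by
  refine GoncharovFormalIteratedIntegrals.WordSeries.ext fun w => ?_
  rw [GoncharovFormalIteratedIntegrals.WordSeries.mul_apply]
  simp only [phiK_apply]
  exact Im_path ha1 hamul x y z w

/-- `Φ_{x,x} = 1` for `Iᵐ_a` (I0, I1). [cite: Brown2012, §2.4 I0, I1] -/
theorem phiK_Im_self (ha1 : a [] = 1) (x : Bool) : phiK (Im a) x x = 1 := by
  refine GoncharovFormalIteratedIntegrals.WordSeries.ext fun w => ?_
  rcases w with _ | ⟨s, w⟩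
  · rw [phiK_apply, Im_nil, ha1]; rfl
  · rw [phiK_apply, Im_self a x (List.cons_ne_nil s w)]; rfl

/-- `Φ_{0,1} = a` for `Iᵐ_a` ((2.8)). [cite: Brown2012, §2.2 (2.8)] -/
theorem phiK_Im_false_true : phiK (Im a) false true = a := by
  refine GoncharovFormalIteratedIntegrals.WordSeries.ext fun w => ?_
  rw [phiK_apply, Im_false_true]

/-- `Φ_{1,0} = a⁻¹`, the antipode `w ↦ (-1)^{|w|} a(w̃)` of the point `a` (I3); it is the inverse of
`a` for the concatenation product (`phiK_Im_mul` at `(0,1,0)` and `(1,0,1)` with `phiK_Im_self`).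
[cite: Brown2012, §2.4 I3] -/
theorem phiK_Im_true_false_apply (w : List Bool) :
    phiK (Im a) true false w = ((-1 : ℚ) ^ w.length) • a w.reverse := by
  rw [phiK_apply, Im_true_false]

/-- `a · a⁻¹ = 1` for a point `a` of `₀Π₁`. [cite: Brown2012, §2.4 I3; Reutenauer1993, §1.6] -/
theorem phiK_Im_mul_inv (ha1 : a [] = 1)
    (hamul : ∀ u v : List Bool, a u * a v = ((shuffleWord u v).map a).sum) :
    phiK (Im a) false true * phiK (Im a) true false = 1 := by
  rw [phiK_Im_mul a ha1 hamul, phiK_Im_self a ha1]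

/-- `a⁻¹ · a = 1` for a point `a` of `₀Π₁`. [cite: Brown2012, §2.4 I3; Reutenauer1993, §1.6] -/
theorem phiK_Im_inv_mul (ha1 : a [] = 1)
    (hamul : ∀ u v : List Bool, a u * a v = ((shuffleWord u v).map a).sum) :
    phiK (Im a) true false * phiK (Im a) false true = 1 := by
  rw [phiK_Im_mul a ha1 hamul, phiK_Im_self a ha1]

/-- **Ihara's `⟨a⟩(e₁) = a e₁ a⁻¹`** for the family of a point. [cite: DeligneGoncharov2005,
(5.11.2), (5.11.4)] -/
theorem iharaWord_Im_true :
    iharaWord (Im a) [true] = phiK (Im a) false true * X true * phiK (Im a) true false :=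
  GoncharovFormalIteratedIntegrals.iharaWord_true _

/-- **Ihara's `⟨a⟩(e₀) = e₀`** for the family of a point. [cite: DeligneGoncharov2005, (5.11.1),
(5.11.4)] -/
theorem iharaWord_Im_false (ha1 : a [] = 1) : iharaWord (Im a) [false] = X false :=
  GoncharovFormalIteratedIntegrals.iharaWord_false _ (phiK_Im_self a ha1 false)

/-- **Goncharov's coproduct paired with a point is Ihara's map**: for a point `a` of `₀Π₁` and any
family `J`, `Σ_{splittings of w} J(0; kept; 1) ∏ Iᵐ_a(gaps) = (⟨a⟩(Φ^J_{0,1}) · a)(w)`.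
[cite: Brown2012, Theorem 2.4; DeligneGoncharov2005, Prop. 5.11, (5.12.1); Goncharov2005, Thm 1.2] -/
theorem conv_Im_eq_iharaMul (ha1 : a [] = 1)
    (hamul : ∀ u v : List Bool, a u * a v = ((shuffleWord u v).map a).sum)
    (J : Bool → List Bool → Bool → B) (w : List Bool) :
    conv J (Im a) false w true = iharaMul (Im a) (phiK J false true) w :=
  conv_eq_iharaMul (Im a) (phiK_Im_mul a ha1 hamul) (phiK_Im_self a ha1 false) J w

end Point

/-! ## The coalgebra condition `ρ_coalg` is the homomorphy of the orbit map for Ihara's law -/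

section Orbit

variable (ρ : List Bool → UAlg)

/-- The Galois family of the first universal point `g = inl : 𝒰' → 𝒰' ⊗ 𝒰'`: the values
`Iᵐ_ρ(x; w; y) ⊗ 1` of `g` on the paths between tangential base points, i.e. the family `Iᵐ_{a_g}`
of the point `a_g = g·₀1₁`. [cite: Brown2012, §2.1 (2.4), (2.6); DeligneGoncharov2005, Prop. 5.11] -/
def orbitFamilyL (x : Bool) (w : List Bool) (y : Bool) : UU := leftEmb (Im ρ x w y)

/-- The point `a_h = h·₀1₁ = 1 ⊗ ρ` of the second universal point `h = inr : 𝒰' → 𝒰' ⊗ 𝒰'`.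
[cite: Brown2012, §2.1 (2.4), (2.6)] -/
def orbitR : GoncharovFormalIteratedIntegrals.WordSeries Bool UU := fun w => algebraMap UAlg UU (ρ w)

/-- The point `a_g = g·₀1₁ = ρ ⊗ 1` of the first universal point is `Φ_{0,1}` of its family.
[cite: Brown2012, §2.1 (2.4), (2.6)] -/
theorem phiK_orbitFamilyL_false_true (w : List Bool) :
    phiK (orbitFamilyL ρ) false true w = leftEmb (ρ w) := by
  rw [phiK_apply, orbitFamilyL, Im_false_true]

/-- (iii) for the family of the first universal point. [cite: Goncharov2005, Prop 2.2] -/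
theorem phiK_orbitFamilyL_mul (hρ1 : ρ [] = 1)
    (hρmul : ∀ u v : List Bool, ρ u * ρ v = ((shuffleWord u v).map ρ).sum) (x y z : Bool) :
    phiK (orbitFamilyL ρ) x y * phiK (orbitFamilyL ρ) y z = phiK (orbitFamilyL ρ) x z :=
  phiK_mul_of_eq ρ leftEmb (fun _ _ _ => rfl) hρ1 hρmul x y z

/-- `Φ_{0,0} = 1` for the family of the first universal point. [cite: Brown2012, §2.4 I0, I1] -/
theorem phiK_orbitFamilyL_self (hρ1 : ρ [] = 1) (x : Bool) : phiK (orbitFamilyL ρ) x x = 1 := by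
  refine GoncharovFormalIteratedIntegrals.WordSeries.ext fun w => ?_
  rcases w with _ | ⟨s, w⟩
  · rw [phiK_apply, orbitFamilyL, Im_nil, hρ1, map_one]; rfl
  · rw [phiK_apply, orbitFamilyL, Im_self ρ x (List.cons_ne_nil s w), map_zero]; rfl

/-- **`ρ_coalg` is Ihara homomorphy.** The right-hand side of the coalgebra condition of
`MotivicGaloisData.ofCoalgebraMap` — Goncharov's coproduct of `w` read through `ρ ⊗ ρ` — is the
coefficient of `w` in `⟨a_g⟩(a_h) · a_g` for the universal pair `(g, h) = (inl, inr)` of points of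
`G_𝒰'`, `a_g = g·₀1₁ = ρ ⊗ 1`, `a_h = h·₀1₁ = 1 ⊗ ρ`. Hence "`ρ` is a coalgebra map for
Goncharov's `Δ` and deconcatenation" says exactly `(gh)·₀1₁ = ⟨g·₀1₁⟩(h·₀1₁)·(g·₀1₁)`: the orbit
map `G_𝒰' → ₀Π₁` is a homomorphism for Ihara's law [DG05, (5.12.1)].
[cite: Brown2012, §2.1 (2.4)–(2.6), Theorem 2.4; DeligneGoncharov2005, Prop. 5.11, (5.12.1)] -/
theorem coalgRHS_eq_iharaMul (hρ1 : ρ [] = 1)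
    (hρmul : ∀ u v : List Bool, ρ u * ρ v = ((shuffleWord u v).map ρ).sum) (w : List Bool) :
    coalgRHS ρ false w true = iharaMul (orbitFamilyL ρ) (orbitR ρ) w := by
  rw [coalgRHS_eq_conv]
  have hJ : phiK (fun x c y => algebraMap UAlg UU (Im ρ x c y)) false true = orbitR ρ :=
    GoncharovFormalIteratedIntegrals.WordSeries.ext fun c => by
      rw [phiK_apply, Im_false_true]; rfl
  rw [← hJ]
  exact conv_eq_iharaMul (orbitFamilyL ρ) (phiK_orbitFamilyL_mul ρ hρ1 hρmul)
    (phiK_orbitFamilyL_self ρ hρ1 false) _ w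

end Orbit

namespace MotivicGaloisData

/-- **The bundle from an Ihara homomorphism** ([DG05, (5.10.3), Prop. 5.11, (5.12.1), (5.15.1)]:
`G_ω = 𝔾_m ⋉ U_ω → H_ω = 𝔾_m ⋉ V_ω`, `V_ω ≅ Π` by `v ↦ v(1_{1,0})` with group law
`a ∘ b = a·⟨a⟩₀(b)`): as `ofCoalgebraMap`, but the coalgebra condition on `ρ` is replaced by the
homomorphy of the orbit map `g ↦ g·₀1₁` from `G_𝒰'` (product of points = convolution, dual to
deconcatenation) to `₀Π₁` with Ihara's law, stated at the universal pair of points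
`(inl, inr) : 𝒰' → 𝒰' ⊗ 𝒰'` whose product is the generic point `dec`:
`ρ_hom : dec(ρ(w)) = (⟨ρ ⊗ 1⟩(1 ⊗ ρ) · (ρ ⊗ 1))(w)`. Goncharov's formula for the coaction
(Brown's Theorem 2.4) is then the theorem `coalgRHS_eq_iharaMul`.
[cite: Brown2012, §2.1 (2.3)–(2.6), Theorem 2.4; DeligneGoncharov2005, (5.10.3), Prop. 5.11,
(5.12.1), (5.15.1)] -/
def ofIharaHom (ρ : List Bool → UAlg) (ρ_nil : ρ [] = 1)
    (ρ_mul : ∀ u v : List Bool, ρ u * ρ v = ((shuffleWord u v).map ρ).sum)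
    (ρ_mem : ∀ w : List Bool, ρ w ∈ uPrime w.length)
    (ρ_hom : ∀ w : List Bool, decHom (ρ w) = iharaMul (orbitFamilyL ρ) (orbitR ρ) w)
    (γ : List Bool → ℚ) (γ_nil : γ [] = 1)
    (γ_mul : ∀ u v : List Bool, γ u * γ v = ((shuffleWord u v).map γ).sum)
    (γ_odd : ∀ w : List Bool, Odd w.length → γ w = 0)
    (g : List ℕ → ℝ) (g_nil : g [] = 1)
    (g_mul : ∀ a b : List ℕ, g a * g b = ((shuffleWord a b).map g).sum) (t₀ : ℝ)
    (period : ∀ s : List ℕ, IsAdmissible s →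
      perLin g t₀ (Ψ ρ γ (rho s.reverse)) = multipleZeta s) : MotivicGaloisData :=
  ofCoalgebraMap ρ ρ_nil ρ_mul ρ_mem (fun w => by
      rw [ρ_hom w, ← coalgRHS_eq_iharaMul ρ ρ_nil ρ_mul w, coalgRHS]
      simp only [Im_false_true])
    γ γ_nil γ_mul γ_odd g g_nil g_mul t₀ period

/-- The constructor does not change `ρ`. [folklore] -/
@[simp] theorem ofIharaHom_ρ (ρ : List Bool → UAlg) (ρ_nil ρ_mul ρ_mem ρ_hom)
    (γ : List Bool → ℚ) (γ_nil γ_mul γ_odd) (g : List ℕ → ℝ) (g_nil g_mul) (t₀ : ℝ) (period) :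
    (ofIharaHom ρ ρ_nil ρ_mul ρ_mem ρ_hom γ γ_nil γ_mul γ_odd g g_nil g_mul t₀ period).ρ = ρ :=
  rfl

end MotivicGaloisData

/-- **Brown's package from an Ihara homomorphism**: a graded shuffle character
`ρ : 𝒪(₀Π₁) → 𝒰'` whose orbit map `G_𝒰' → ₀Π₁` is a homomorphism for Ihara's law
([DG05, Prop. 5.11, (5.12.1), (5.15.1)]), an even rational point `γ` and a real period point
`(g, t₀)` matching the multiple zeta values on convergent words yield an inhabitant of
`MotivicMZV`; Goncharov's formula for the coaction (Theorem 2.4), its multiplicativity and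
coassociativity, and all of §§2.2–2.5, §3.1 are theorems of the tree.
[cite: Brown2012, §§2.1–2.5, §3.1; DeligneGoncharov2005, 5.10–5.16; Goncharov2005, Prop 2.2,
Thm 2.5] -/
theorem motivicMZV_nonempty_of_iharaHom (ρ : List Bool → UAlg) (ρ_nil : ρ [] = 1)
    (ρ_mul : ∀ u v : List Bool, ρ u * ρ v = ((shuffleWord u v).map ρ).sum)
    (ρ_mem : ∀ w : List Bool, ρ w ∈ uPrime w.length)
    (ρ_hom : ∀ w : List Bool, decHom (ρ w) = iharaMul (orbitFamilyL ρ) (orbitR ρ) w)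
    (γ : List Bool → ℚ) (γ_nil : γ [] = 1)
    (γ_mul : ∀ u v : List Bool, γ u * γ v = ((shuffleWord u v).map γ).sum)
    (γ_odd : ∀ w : List Bool, Odd w.length → γ w = 0)
    (g : List ℕ → ℝ) (g_nil : g [] = 1)
    (g_mul : ∀ a b : List ℕ, g a * g b = ((shuffleWord a b).map g).sum) (t₀ : ℝ)
    (period : ∀ s : List ℕ, IsAdmissible s →
      perLin g t₀ (Ψ ρ γ (rho s.reverse)) = multipleZeta s) :
    motivicMZV_nonempty :=
  ⟨(MotivicGaloisData.ofIharaHom ρ ρ_nil ρ_mul ρ_mem ρ_hom γ γ_nil γ_mul γ_odd g g_nil g_mul t₀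
    period).toMotivicMZV⟩

end Brown2012

end Literature.NumberTheory.Transcendental
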